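import Summits.QuantumFields.GaugeBoot.CentreSheetTwist
import Summits.QuantumFields.GaugeBoot.GaugeInvariantBootstrap
import HarnessLib

/-!
# Internal symmetries of the bootstrap IV: `ℤ_N` centre symmetry — every solution has vanishing Polyakov loops (gauge-boot, L1 supplement)

HONEST FRAMING (cell `pub-gaugeboot`, page 1 of every file): the venture produces certified bounds
on lattice expectations at stated coupling, gauge group, dimension and torus size; NOT a mass gap,
NOT a continuum limit, NOT a string tension; NOT Yang–Mills-summit-bearing (barriers
`FixedCouplingUltralocality`, `PerturbativeInvisibility`). Structural; it certifies no number.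
Nothing here concerns temperature, deconfinement or infinite volume.

## Content

`CentreSheetTwist` showed that twisting the links leaving the sheet `{x_m = 0}` by a central element
is a symmetry of every solution of the untruncated bootstrap. For `SU(N)` take the generator of the
centre, `centreRoot N = e^{2πi/N}·1`:

* `centreRoot`, `centreRoot_mem_center`, `coe_centreRoot` — `ω·1 ∈ Z(SU(N))`, `ω = e^{2πi/N}`;
* `wordHolonomy_comp_translateEquiv`, `loopRe_comp_translate` / `loopIm_comp_translate` — translating
  the configuration translates the base point of a Wilson loop;
* `loopRe_polyakov_comp_sheetTwist` / `loopIm_…` — a Polyakov loop based on the sheet is ROTATED by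
  the twist: `(Re, Im) tr hol ↦ R_{2π/N} (Re, Im) tr hol`;
* ★★★ `polyakov_eq_zero_of_bootstrap_suN` — `SU(N)`, `N ≥ 2`, torus `(ℤ/L)^d`, ANY real `β`: EVERY
  solution of the untruncated bootstrap (normalisation, square-positivity, loop equations) assigns `0`
  to the real and imaginary parts of EVERY Polyakov loop `tr hol_y(L·e_m)` (any base point `y`, any
  direction `m`) — a rotation by `2π/N ≠ 0` has no nonzero fixed vector; the base point is moved to
  the sheet by translation invariance of solutions (`bootstrap_translationInvariant_suN`);
* ★★★ `wilson_polyakov_eq_zero_suN` — in particular the Wilson state: `∫ Re/Im tr hol_y(P_m) dμ = 0`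
  (the tree's `wilsonExpectation_polyakovLine_eq_zero` covered `SU(2n)` via the `ℤ₂` subgroup; this is
  the full `ℤ_N` statement, all `N ≥ 2`); ★★ `polyakov_eq_zero_of_gaugeInvariantBootstrap_suN` — the
  same for the bootstrap on gauge-invariant data.

What this is NOT: multiply wound Polyakov loops (`N`-ality `k`: they vanish unless `N ∣ k` — not
typed); nothing at `L → ∞` or about deconfinement.

References: A. M. Polyakov, Phys. Lett. B 72 (1978) 477; G. 't Hooft, Nucl. Phys. B 153 (1979) 141;
B. Svetitsky, L. Yaffe, Nucl. Phys. B 210 (1982) 423; V. Kazakov, Z. Zheng, arXiv:2203.11360 §3.2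
(centre symmetry in the bootstrap). Folklore.
-/

noncomputable section

open MeasureTheory Filter Topology NormedSpace
open scoped Matrix ComplexConjugate
open Literature.MathematicalPhysics.QuantumFieldTheory (LatticeRep Site Edge GaugeConfig IsGaugeInvariant wilsonAction
  wilsonMeasure isProbabilityMeasure_wilsonMeasure)

namespace Summit.QuantumFields.GaugeBoot

/-! ## The generator of the centre of `SU(N)` -/

section Centre

variable (N : ℕ)

/-- `ω = e^{2πi/N}`. [folklore] -/
def centrePhase : ℂ := Complex.exp (2 * Real.pi * Complex.I / N)

/-- `ω = e^{iθ}` with `θ = 2π/N`. -/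
theorem centrePhase_eq_exp_mul_I : centrePhase N = Complex.exp ((2 * Real.pi / N : ℝ) * Complex.I) := by
  unfold centrePhase
  congr 1
  push_cast
  ring

/-- `ω^N = 1`. -/
theorem centrePhase_pow : centrePhase N ^ N = 1 := by
  rcases Nat.eq_zero_or_pos N with hN | hN
  · subst hN; simp
  · exact (Complex.isPrimitiveRoot_exp N hN.ne').pow_eq_one

/-- `ω conj ω = 1`. -/
theorem centrePhase_mul_conj : centrePhase N * conj (centrePhase N) = 1 := by
  rw [centrePhase_eq_exp_mul_I, ← Complex.exp_conj, ← Complex.exp_add, map_mul, Complex.conj_ofReal, Complex.conj_I,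
    mul_neg, add_neg_cancel, Complex.exp_zero]

/-- `Re ω = cos(2π/N)`, `Im ω = sin(2π/N)`. -/
theorem centrePhase_re_im : (centrePhase N).re = Real.cos (2 * Real.pi / N) ∧ (centrePhase N).im = Real.sin (2 * Real.pi / N) := by
  rw [centrePhase_eq_exp_mul_I]
  exact ⟨Complex.exp_ofReal_mul_I_re _, Complex.exp_ofReal_mul_I_im _⟩

/-- **`cos(2π/N) ≠ 1` for `N ≥ 2`.** -/
theorem cos_two_pi_div_ne_one (hN : 2 ≤ N) : Real.cos (2 * Real.pi / N) ≠ 1 := by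
  intro h
  obtain ⟨n, hn⟩ := (Real.cos_eq_one_iff _).1 h
  have hNpos : (0 : ℝ) < N := by exact_mod_cast (by omega : 0 < N)
  have h1 : (n : ℝ) * N = 1 := by
    field_simp at hn
    nlinarith [Real.pi_pos]
  have h2 : (n : ℤ) * (N : ℤ) = 1 := by exact_mod_cast h1
  have h3 := Int.eq_one_or_neg_one_of_mul_eq_one' h2
  rcases h3 with ⟨-, hN1⟩ | ⟨-, hN1⟩ <;> omega

/-- **The centre generator** `ω·1 ∈ SU(N)`. [folklore] -/
def centreRoot : Matrix.specialUnitaryGroup (Fin N) ℂ :=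
  ⟨centrePhase N • (1 : Matrix (Fin N) (Fin N) ℂ), Matrix.mem_specialUnitaryGroup_iff.2
    ⟨Matrix.mem_unitaryGroup_iff.2 (by
        rw [star_smul, Matrix.star_eq_conjTranspose, Matrix.conjTranspose_one, Matrix.smul_mul, Matrix.mul_smul,
          Matrix.one_mul, smul_smul, Complex.star_def, centrePhase_mul_conj, one_smul]),
      by rw [Matrix.det_smul, Matrix.det_one, mul_one, Fintype.card_fin, centrePhase_pow]⟩⟩

/-- The matrix of the centre generator. -/
@[simp] theorem coe_centreRoot : ((centreRoot N : Matrix.specialUnitaryGroup (Fin N) ℂ) : Matrix (Fin N) (Fin N) ℂ) =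
    centrePhase N • (1 : Matrix (Fin N) (Fin N) ℂ) := rfl

/-- **The centre generator is central.** -/
theorem centreRoot_mem_center : centreRoot N ∈ Subgroup.center (Matrix.specialUnitaryGroup (Fin N) ℂ) := by
  rw [Subgroup.mem_center_iff]
  intro g
  apply Subtype.ext
  change (g : Matrix (Fin N) (Fin N) ℂ) * (centrePhase N • (1 : Matrix (Fin N) (Fin N) ℂ)) =
    centrePhase N • (1 : Matrix (Fin N) (Fin N) ℂ) * (g : Matrix (Fin N) (Fin N) ℂ)
  rw [Matrix.mul_smul, Matrix.mul_one, Matrix.smul_mul, Matrix.one_mul]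

end Centre

/-! ## Translating the base point of a Wilson loop -/

section Translate

variable {d L : ℕ} {G : Type*} [Group G]

/-- **Holonomies of a translated configuration**: `hol_y(w)(U(· + a)) = hol_{y+a}(w)(U)`. -/
theorem wordHolonomy_comp_translateEquiv (U : GaugeConfig d L G) (a : Site d L) (y : Site d L) (w : Word d) :
    wordHolonomy (U ∘ translateEquiv a) y w = wordHolonomy U (y + a) w := by
  induction w generalizing y with
  | nil => simp
  | cons s w ih =>
    rw [wordHolonomy_cons, wordHolonomy_cons, ih]
    have hstep : stepHolonomy (U ∘ translateEquiv a) y s = stepHolonomy U (y + a) s := by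
      cases s with
      | fwd μ => simp [stepHolonomy]
      | bwd μ => simp [stepHolonomy, sub_add_eq_add_sub]
    have happ : s.apply y + a = s.apply (y + a) := by
      cases s with
      | fwd μ => simp [Step.apply, Site.shift, add_right_comm]
      | bwd μ => simp [Step.apply, sub_add_eq_add_sub]
    rw [hstep, happ]

variable [TopologicalSpace G] [IsTopologicalGroup G] (r : LatticeRep G)

/-- Translating the configuration translates the base point (`Re tr`). -/
theorem loopRe_comp_translate (a y : Site d L) (w : Word d) :
    (loopRe r y w).comp (relabelCM (translateEquiv a)) = loopRe r (y + a) w := by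
  ext U
  simp only [ContinuousMap.comp_apply, loopRe_apply, coe_relabelCM, wordHolonomy_comp_translateEquiv]

/-- Translating the configuration translates the base point (`Im tr`). -/
theorem loopIm_comp_translate (a y : Site d L) (w : Word d) :
    (loopIm r y w).comp (relabelCM (translateEquiv a)) = loopIm r (y + a) w := by
  ext U
  simp only [ContinuousMap.comp_apply, loopIm_apply, coe_relabelCM, wordHolonomy_comp_translateEquiv]

omit [TopologicalSpace G] [IsTopologicalGroup G] in
/-- Every site is a translate of a site on the sheet `{x_m = 0}`. -/
theorem exists_sheet_translate (y : Site d L) (m : Fin d) :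
    ∃ x a : Site d L, x m = 0 ∧ x + a = y :=
  ⟨y - Pi.single m (y m), Pi.single m (y m), by simp, sub_add_cancel _ _⟩

end Translate

/-! ## `SU(N)`: Polyakov loops under the centre twist -/

section Polyakov

open Literature.MathematicalPhysics.QuantumLattice (fundamentalLatticeRep fundamentalRep continuous_fundamentalRep)

variable {d L : ℕ} [NeZero L] (N : ℕ)

/-- The trace of `ω·h` in the fundamental representation: `tr ρ(centreRoot · h) = ω tr ρ(h)`. -/
theorem rho_trace_centreRoot_mul (h : Matrix.specialUnitaryGroup (Fin N) ℂ) :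
    ((fundamentalLatticeRep N).ρ (centreRoot N * h)).trace = centrePhase N * ((fundamentalLatticeRep N).ρ h).trace := by
  change ((centrePhase N • (1 : Matrix (Fin N) (Fin N) ℂ)) * (h : Matrix (Fin N) (Fin N) ℂ)).trace =
    centrePhase N * ((h : Matrix (Fin N) (Fin N) ℂ)).trace
  rw [Matrix.smul_mul, Matrix.one_mul, Matrix.trace_smul, smul_eq_mul]

/-- ★ **A Polyakov loop on the sheet is ROTATED by the centre twist** (real part):
`Re tr hol ↦ cos(2π/N) Re tr hol - sin(2π/N) Im tr hol`. -/
theorem loopRe_polyakov_comp_sheetTwist (m : Fin d) {x : Site d L} (hx : x m = 0) :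
    (loopRe (fundamentalLatticeRep N) x (polyakovWord m L)).comp
        (sheetTwistCM m (centreRoot N : Matrix.specialUnitaryGroup (Fin N) ℂ)) =
      Real.cos (2 * Real.pi / N) • loopRe (fundamentalLatticeRep N) x (polyakovWord m L) -
        Real.sin (2 * Real.pi / N) • loopIm (fundamentalLatticeRep N) x (polyakovWord m L) := by
  ext U
  simp only [ContinuousMap.comp_apply, ContinuousMap.sub_apply, ContinuousMap.smul_apply, loopRe_apply, loopIm_apply,
    sheetTwistCM_apply, smul_eq_mul]
  rw [wordHolonomy_polyakov_sheetTwist m _ U hx, rho_trace_centreRoot_mul, Complex.mul_re, (centrePhase_re_im N).1,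
    (centrePhase_re_im N).2]

/-- ★ **A Polyakov loop on the sheet is rotated by the centre twist** (imaginary part). -/
theorem loopIm_polyakov_comp_sheetTwist (m : Fin d) {x : Site d L} (hx : x m = 0) :
    (loopIm (fundamentalLatticeRep N) x (polyakovWord m L)).comp
        (sheetTwistCM m (centreRoot N : Matrix.specialUnitaryGroup (Fin N) ℂ)) =
      Real.sin (2 * Real.pi / N) • loopRe (fundamentalLatticeRep N) x (polyakovWord m L) +
        Real.cos (2 * Real.pi / N) • loopIm (fundamentalLatticeRep N) x (polyakovWord m L) := by
  ext U
  simp only [ContinuousMap.comp_apply, ContinuousMap.add_apply, ContinuousMap.smul_apply, loopRe_apply, loopIm_apply,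
    sheetTwistCM_apply, smul_eq_mul]
  rw [wordHolonomy_polyakov_sheetTwist m _ U hx, rho_trace_centreRoot_mul, Complex.mul_im, (centrePhase_re_im N).1,
    (centrePhase_re_im N).2]
  ring

/-- A vector fixed by a nontrivial rotation vanishes. -/
theorem eq_zero_of_rotation_fixed {c s A B : ℝ} (hc : c ≠ 1) (hcs : c ^ 2 + s ^ 2 = 1)
    (hA : c * A - s * B = A) (hB : s * A + c * B = B) : A = 0 ∧ B = 0 := by
  have h3 : (1 - c) * (A ^ 2 + B ^ 2) = 0 := by linear_combination (-A) * hA - B * hB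
  have h4 : A ^ 2 + B ^ 2 = 0 := by
    rcases mul_eq_zero.1 h3 with h | h
    · exact absurd (by linarith : c = 1) hc
    · exact h
  have _ := hcs
  constructor <;> nlinarith [sq_nonneg A, sq_nonneg B]

variable (β : ℝ)

/-- ★★★ **`SU(N)`, `N ≥ 2`, any real `β`, any torus: every solution of the untruncated bootstrap
assigns `0` to every Polyakov loop** (`Re` and `Im tr hol_y(L·e_m)`, every base point `y`, every
direction `m`). Unbroken centre symmetry in finite volume, as a property of ALL solutions of the
loop equations + positivity + normalisation. [folklore] -/
theorem polyakov_eq_zero_of_bootstrap_suN (hN : 2 ≤ N)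
    {φ : C(GaugeConfig d L (Matrix.specialUnitaryGroup (Fin N) ℂ), ℝ) →ₗ[ℝ] ℝ} (h1 : φ 1 = 1)
    (hpos : ∀ a ∈ polyAlgebra (ι := Edge d L) (fundamentalLatticeRep N), 0 ≤ φ (a * a))
    (hφ : IsSDFunctional (fundamentalLatticeRep N) (suExp N) (fun _ => wilsonAction (fundamentalRep (Fin N))) β φ)
    (y : Site d L) (m : Fin d) :
    φ (loopRe (fundamentalLatticeRep N) y (polyakovWord m L)) = 0 ∧
      φ (loopIm (fundamentalLatticeRep N) y (polyakovWord m L)) = 0 := by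
  -- move the base point to the sheet
  obtain ⟨x, a, hx, rfl⟩ := exists_sheet_translate y m
  rw [← loopRe_comp_translate, ← loopIm_comp_translate,
    bootstrap_translationInvariant_suN N β h1 hpos hφ a (loopRe_mem _ x _),
    bootstrap_translationInvariant_suN N β h1 hpos hφ a (loopIm_mem _ x _)]
  -- invariance under the centre twist = invariance under a rotation by `2π/N`
  have hA := bootstrap_sheetTwistInvariant_suN N β m (centreRoot_mem_center N) h1 hpos hφ
    (loopRe_mem (fundamentalLatticeRep N) x (polyakovWord m L))
  have hB := bootstrap_sheetTwistInvariant_suN N β m (centreRoot_mem_center N) h1 hpos hφ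
    (loopIm_mem (fundamentalLatticeRep N) x (polyakovWord m L))
  rw [loopRe_polyakov_comp_sheetTwist N m hx, map_sub, map_smul, map_smul, smul_eq_mul, smul_eq_mul] at hA
  rw [loopIm_polyakov_comp_sheetTwist N m hx, map_add, map_smul, map_smul, smul_eq_mul, smul_eq_mul] at hB
  exact eq_zero_of_rotation_fixed (cos_two_pi_div_ne_one N hN) (Real.cos_sq_add_sin_sq _) hA hB

/-- ★★★ **The Wilson state of `SU(N)` (`N ≥ 2`) has vanishing Polyakov loops**: `∫ Re tr hol_y(P_m) dμ = 0`
and `∫ Im tr hol_y(P_m) dμ = 0`, every `β`, `d`, `L`, `y`, `m` — derived here from the bootstrap (the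
Wilson expectation functional is a solution, `bootstrap_wilson_suN`). [folklore] -/
theorem wilson_polyakov_eq_zero_suN (hN : 2 ≤ N) (y : Site d L) (m : Fin d) :
    ∫ U, loopRe (fundamentalLatticeRep N) y (polyakovWord m L) U ∂(wilsonMeasure (d := d) (L := L) (fundamentalRep (Fin N)) β) = 0 ∧
      ∫ U, loopIm (fundamentalLatticeRep N) y (polyakovWord m L) U ∂(wilsonMeasure (d := d) (L := L) (fundamentalRep (Fin N)) β) = 0 := by
  haveI : IsProbabilityMeasure (wilsonMeasure (d := d) (L := L) (fundamentalRep (Fin N)) β) :=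
    isProbabilityMeasure_wilsonMeasure (ρ := fundamentalRep (Fin N)) (continuous_fundamentalRep _) β
  obtain ⟨h1, hpos, hsd⟩ := bootstrap_wilson_suN (d := d) (L := L) N β (wilsonMeasure (fundamentalRep (Fin N)) β) rfl
  have h := polyakov_eq_zero_of_bootstrap_suN N β hN h1 (fun a _ => hpos a) hsd y m
  rwa [expectationFunctional_apply, expectationFunctional_apply] at h

/-- ★★ **The bootstrap on gauge-invariant data has vanishing Polyakov loops** (`SU(N)`, `N ≥ 2`;
loop positivity + gauge-averaged loop equations + normalisation). [folklore] -/
theorem polyakov_eq_zero_of_gaugeInvariantBootstrap_suN (hN : 2 ≤ N)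
    {ψ : C(GaugeConfig d L (Matrix.specialUnitaryGroup (Fin N) ℂ), ℝ) →ₗ[ℝ] ℝ} (h1 : ψ 1 = 1)
    (hpos : ∀ a ∈ polyAlgebra (ι := Edge d L) (fundamentalLatticeRep N), 0 ≤ ψ (gaugeAvgL d L _ (a * a)))
    (hψ : IsSDFunctional (fundamentalLatticeRep N) (suExp N) (fun _ => wilsonAction (fundamentalRep (Fin N))) β
      (ψ ∘ₗ gaugeAvgL d L _))
    (y : Site d L) (m : Fin d) :
    ψ (loopRe (fundamentalLatticeRep N) y (polyakovWord m L)) = 0 ∧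
      ψ (loopIm (fundamentalLatticeRep N) y (polyakovWord m L)) = 0 := by
  have hcl := endpoint_polyakovWord_self (d := d) (L := L) y m
  rw [eq_wilson_of_gaugeInvariantBootstrap_suN N β h1 hpos hψ (loopRe_mem _ y _) (isGaugeInvariant_loopRe _ y hcl),
    eq_wilson_of_gaugeInvariantBootstrap_suN N β h1 hpos hψ (loopIm_mem _ y _) (isGaugeInvariant_loopIm _ y hcl)]
  exact wilson_polyakov_eq_zero_suN N β hN y m

end Polyakov

end Summit.QuantumFields.GaugeBoot

end
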